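import Summits.Ventures.PercRepro.Night2BasisMass

/-!
# night-2: the targets of a basis pair with a given coloop lie in one hyperplane

For a basis pair `(B, z)` (`Q = insert z B`, `Q' = Q ∖ K` a basis of `V`) and a point `w ∈ Q'`, every target `T ⊇ Q`
of which `w` is a coloop off `K` has `T ∖ {w} ⊆ clF (Q.erase w)` (`T' ∖ w` has rank `4` and contains `Q' ∖ w` of
rank `4`), so the number of such targets is at most `2^{|(G ∩ clF (Q.erase w)) ∖ Q|}` (`card_targets_coloop_le`), and
the targets with some coloop off `K` are at most the sum of these over the five points of `Q'`
(`card_targets_some_coloop_le`) — the counts of the targets by coloop type (paper NIGHT-2-g31 §3.3 (2)).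
-/

namespace PercRepro.Shadow

open PercRepro.ThmH PercRepro.PerFlat

variable {α : Type*} [DecidableEq α] {M : Matroid α} [M.Finite] {G : Finset α}

/-- A target of a basis pair with the coloop `w ∈ Q'` off `K` satisfies `T ∖ K ∖ {w} ⊆ clF (Q.erase w)`. -/
theorem erase_subset_clF_of_coloop (hG : G ∈ flatsQ M (5 + 1)) (hd : (gr M \ G).card = 2)
    (hk : kColoops M G = 1) {B : Finset α} (hB : B ∈ thinMembers M 5 G) (hnP : ¬ bigP M G B) {z : α}
    (hz : z ∈ G \ clF M B) {w : α} (hw : w ∈ insert z B \ coloops M G) {T : Finset α}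
    (hT : T ∈ tgtSets M 5 G B z) (hwT : w ∈ coloops M (T \ coloops M G)) :
    (T \ coloops M G).erase w ⊆ clF M ((insert z B).erase w) := by
  have hd' : (gr M \ G).card ≤ 5 := by omega
  have hGg : G ⊆ gr M := (mem_flatsQ.1 hG).1
  have hTG : T ⊆ G := subset_G_of_mem_shadowAt (mem_tgtSets.1 hT).1
  have hQT : insert z B ⊆ T := (mem_tgtSets.1 hT).2.1
  have hKB : coloops M G ⊆ B := coloops_subset_of_mem_thinMembers hG hd' hB
  have hBG : B ⊆ G := subset_G_of_mem_thinMembers hB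
  have hzG : z ∈ G := (Finset.mem_sdiff.1 hz).1
  have hQG : insert z B ⊆ G := Finset.insert_subset hzG hBG
  have hKQ : coloops M G ⊆ insert z B := hKB.trans (Finset.subset_insert _ _)
  have hKT : coloops M G ⊆ T := hKQ.trans hQT
  set Q' := insert z B \ coloops M G with hQ'
  set T' := T \ coloops M G with hT'
  have hQ'T' : Q' ⊆ T' := Finset.sdiff_subset_sdiff hQT (Finset.Subset.refl _)
  have hT'g : T' ⊆ gr M := Finset.sdiff_subset.trans (hTG.trans hGg)
  have hQ'g : Q' ⊆ gr M := hQ'T'.trans hT'g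
  -- ranks: `rk Q' = 5 = rk T'`
  have hrQ : rkN M (insert z B) = 6 := by
    rw [rkN_insert_of_notMem_clF (hGg hzG) (Finset.mem_sdiff.1 hz).2, rkN_eq_five_of_mem_thinMembers hB]
  have hrQ' : rkN M Q' = 5 := by
    have := rkN_eq_rkN_sdiff_add_one hG hk (S := insert z B) hQG (Finset.Subset.refl _) hKQ
    rw [← hQ'] at this
    omega
  have hrT' : rkN M T' = 5 := by
    have h1 := rkN_mono (M := M) hQ'T'
    have h2 := rkN_mono (M := M) (show T' ⊆ G \ coloops M G from Finset.sdiff_subset_sdiff hTG (Finset.Subset.refl _))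
    rw [rkN_sdiff_coloops_eq_five hG hk] at h2
    omega
  -- `rk (T' ∖ w) = 4`
  have hrTw : rkN M (T'.erase w) = 4 := by
    have := rkN_sdiff_add_card_of_subset_coloops (M := M) hT'g (T := {w})
      (Finset.singleton_subset_iff.2 hwT)
    rw [Finset.sdiff_singleton_eq_erase, Finset.card_singleton, hrT'] at this
    omega
  -- `rk (Q' ∖ w) = 4`: at most `4` points, at least `5 − 1`
  have hwQ' : w ∈ Q' := hw
  have hrQw : rkN M (Q'.erase w) = 4 := by
    have hB4 := card_sdiff_eq_four_of_not_bigP hG hd hk hB hnP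
    have hzB : z ∉ B := fun h => (Finset.mem_sdiff.1 hz).2 (subset_clF_of_subset_gr (hBG.trans hGg) h)
    have hzK : z ∉ coloops M G := fun h => hzB (hKB h)
    have hcard : Q'.card = 5 := by
      rw [hQ', Finset.insert_sdiff_of_notMem _ hzK, Finset.card_insert_of_notMem (fun h => hzB (Finset.mem_sdiff.1 h).1), hB4]
    have h1 := rkN_le_card (M := M) (Q'.erase w)
    rw [Finset.card_erase_of_mem hwQ', hcard] at h1
    have h2 := rkN_union_le_rkN_add_card (M := M) (Q'.erase w) {w}
    rw [Finset.card_singleton] at h2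
    have h3 : Q'.erase w ∪ {w} = Q' := by
      rw [Finset.union_comm, ← Finset.insert_eq, Finset.insert_erase hwQ']
    rw [h3, hrQ'] at h2
    omega
  -- `T' ∖ w ⊆ clF (Q' ∖ w) ⊆ clF (Q ∖ w)`
  have hsub : Q'.erase w ⊆ T'.erase w := Finset.erase_subset_erase _ hQ'T'
  intro a ha
  have h1 : a ∈ clF M (Q'.erase w) :=
    mem_clF_of_rkN_eq hsub ((Finset.erase_subset _ _).trans hT'g) (by rw [hrQw, hrTw]) ha
  exact clF_mono (Finset.erase_subset_erase _ Finset.sdiff_subset) h1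

/-- **The targets of a basis pair with the coloop `w ∈ Q'` off `K` number at most `2^{|(G ∩ clF (Q.erase w)) ∖ Q|}`.** -/
theorem card_targets_coloop_le (hG : G ∈ flatsQ M (5 + 1)) (hd : (gr M \ G).card = 2)
    (hk : kColoops M G = 1) {B : Finset α} (hB : B ∈ thinMembers M 5 G) (hnP : ¬ bigP M G B) {z : α}
    (hz : z ∈ G \ clF M B) {w : α} (hw : w ∈ insert z B \ coloops M G) :
    ((tgtSets M 5 G B z).filter (fun T => w ∈ coloops M (T \ coloops M G))).card ≤
      2 ^ ((G ∩ clF M ((insert z B).erase w)) \ insert z B).card := by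
  have hd' : (gr M \ G).card ≤ 5 := by omega
  rw [← Finset.card_powerset]
  apply Finset.card_le_card_of_injOn (fun T => T \ insert z B)
  · intro T hT
    rw [Finset.mem_coe, Finset.mem_filter] at hT
    rw [Finset.mem_coe, Finset.mem_powerset]
    have hTG : T ⊆ G := subset_G_of_mem_shadowAt (mem_tgtSets.1 hT.1).1
    have hsub := erase_subset_clF_of_coloop hG hd hk hB hnP hz hw hT.1 hT.2
    intro a ha
    rw [Finset.mem_sdiff] at ha
    have hKQ : coloops M G ⊆ insert z B :=
      (coloops_subset_of_mem_thinMembers hG hd' hB).trans (Finset.subset_insert _ _)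
    have haK : a ∉ coloops M G := fun h => ha.2 (hKQ h)
    have haw : a ≠ w := fun h => ha.2 (h ▸ (Finset.mem_sdiff.1 hw).1)
    rw [Finset.mem_sdiff, Finset.mem_inter]
    exact ⟨⟨hTG ha.1, hsub (Finset.mem_erase.2 ⟨haw, Finset.mem_sdiff.2 ⟨ha.1, haK⟩⟩)⟩, ha.2⟩
  · intro T hT T' hT' heq
    rw [Finset.mem_coe, Finset.mem_filter] at hT hT'
    have hQT : insert z B ⊆ T := (mem_tgtSets.1 hT.1).2.1
    have hQT' : insert z B ⊆ T' := (mem_tgtSets.1 hT'.1).2.1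
    simp only at heq
    rw [← Finset.union_sdiff_of_subset hQT, ← Finset.union_sdiff_of_subset hQT', heq]

/-- **The targets of a basis pair with some coloop off `K`** number at most the sum over the five points `w` of `Q'`
of `2^{|(G ∩ clF (Q.erase w)) ∖ Q|}`. -/
theorem card_targets_some_coloop_le (hG : G ∈ flatsQ M (5 + 1)) (hd : (gr M \ G).card = 2)
    (hk : kColoops M G = 1) {B : Finset α} (hB : B ∈ thinMembers M 5 G) (hnP : ¬ bigP M G B) {z : α}
    (hz : z ∈ G \ clF M B) :
    ((tgtSets M 5 G B z).filter (fun T => (coloops M (T \ coloops M G)).Nonempty)).card ≤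
      ∑ w ∈ insert z B \ coloops M G, 2 ^ ((G ∩ clF M ((insert z B).erase w)) \ insert z B).card := by
  have hd' : (gr M \ G).card ≤ 5 := by omega
  have hGg : G ⊆ gr M := (mem_flatsQ.1 hG).1
  -- a coloop of `T ∖ K` lies in `Q'`: a point of `T' ∖ Q'` is spanned by `Q'`
  have hcol : ∀ T ∈ tgtSets M 5 G B z, ∀ w ∈ coloops M (T \ coloops M G), w ∈ insert z B \ coloops M G := by
    intro T hT w hw
    have hTG : T ⊆ G := subset_G_of_mem_shadowAt (mem_tgtSets.1 hT).1
    have hQT : insert z B ⊆ T := (mem_tgtSets.1 hT).2.1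
    have hwT : w ∈ T \ coloops M G := (mem_coloops.1 hw).1
    by_contra hwQ
    have hQ'T' : insert z B \ coloops M G ⊆ (T \ coloops M G).erase w := by
      intro a ha
      exact Finset.mem_erase.2 ⟨fun h => hwQ (h ▸ ha), Finset.sdiff_subset_sdiff hQT (Finset.Subset.refl _) ha⟩
    have hT'g : T \ coloops M G ⊆ gr M := Finset.sdiff_subset.trans (hTG.trans hGg)
    have hrQ' : rkN M (insert z B \ coloops M G) = 5 := by
      have hzG : z ∈ G := (Finset.mem_sdiff.1 hz).1
      have hQG : insert z B ⊆ G := Finset.insert_subset hzG (subset_G_of_mem_thinMembers hB)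
      have hKQ : coloops M G ⊆ insert z B :=
        (coloops_subset_of_mem_thinMembers hG hd' hB).trans (Finset.subset_insert _ _)
      have h1 := rkN_eq_rkN_sdiff_add_one hG hk (S := insert z B) hQG (Finset.Subset.refl _) hKQ
      rw [rkN_insert_of_notMem_clF (hGg hzG) (Finset.mem_sdiff.1 hz).2, rkN_eq_five_of_mem_thinMembers hB] at h1
      omega
    have hrT' : rkN M ((T \ coloops M G).erase w) ≤ 5 := by
      have := rkN_mono (M := M) (show (T \ coloops M G).erase w ⊆ G \ coloops M G from
        (Finset.erase_subset _ _).trans (Finset.sdiff_subset_sdiff hTG (Finset.Subset.refl _)))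
      rw [rkN_sdiff_coloops_eq_five hG hk] at this
      exact this
    have hrge := rkN_mono (M := M) hQ'T'
    have hwcl : w ∈ clF M ((T \ coloops M G).erase w) := by
      have h1 : w ∈ clF M (insert z B \ coloops M G) :=
        mem_clF_of_rkN_eq (Finset.sdiff_subset_sdiff hQT (Finset.Subset.refl _)) hT'g (by
          have := rkN_mono (M := M) (show T \ coloops M G ⊆ G \ coloops M G from
            Finset.sdiff_subset_sdiff hTG (Finset.Subset.refl _))
          rw [rkN_sdiff_coloops_eq_five hG hk] at this
          have h2 := rkN_mono (M := M) (Finset.sdiff_subset_sdiff hQT (Finset.Subset.refl _) :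
            insert z B \ coloops M G ⊆ T \ coloops M G)
          omega) hwT
      exact clF_mono hQ'T' h1
    exact (mem_coloops.1 hw).2 hwcl
  -- union bound
  calc ((tgtSets M 5 G B z).filter (fun T => (coloops M (T \ coloops M G)).Nonempty)).card
      ≤ ((insert z B \ coloops M G).biUnion (fun w =>
          (tgtSets M 5 G B z).filter (fun T => w ∈ coloops M (T \ coloops M G)))).card := by
        apply Finset.card_le_card
        intro T hT
        rw [Finset.mem_filter] at hT
        obtain ⟨w, hw⟩ := hT.2
        rw [Finset.mem_biUnion]
        exact ⟨w, hcol T hT.1 w hw, Finset.mem_filter.2 ⟨hT.1, hw⟩⟩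
    _ ≤ ∑ w ∈ insert z B \ coloops M G, ((tgtSets M 5 G B z).filter
          (fun T => w ∈ coloops M (T \ coloops M G))).card := Finset.card_biUnion_le
    _ ≤ ∑ w ∈ insert z B \ coloops M G, 2 ^ ((G ∩ clF M ((insert z B).erase w)) \ insert z B).card := by
        apply Finset.sum_le_sum
        intro w hw
        exact card_targets_coloop_le hG hd hk hB hnP hz hw

end PercRepro.Shadow
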